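import Summits.CriticalPhenomena.PercolationContinuityZ3.Theorems.SahiMasterFamilyFCombOneSharedClassKH
import Summits.CriticalPhenomena.PercolationContinuityZ3.Theorems.SahiMasterFamilyFCombOneSharedClassDual
import Summits.CriticalPhenomena.PercolationContinuityZ3.Theorems.SahiMasterFamilyFCombOneSharedClassZ
import Summits.CriticalPhenomena.PercolationContinuityZ3.Theorems.SahiMasterFamilyFCombOneSharedClassDisplace
import Summits.CriticalPhenomena.PercolationContinuityZ3.Theorems.SahiMasterFamilyFCombOneSharedClassRow
import Summits.CriticalPhenomena.PercolationContinuityZ3.Theorems.SahiMasterFamilyFCombOneSharedClassLeaver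

/-!
# THEOREM I₁: Conjecture V (untwisted) for one-shared-coordinate pairs (support file)

Support file (prover seat `prim-bnk-2`, gen 32; `--supports stmt-CriticalPhenomena-4575`).  Proof document
`run/shared/lean/prim/prim-l12/prim-bnk-2/PROOF-THEOREM-I1.md` (SCHEME Σ of gen 30 with the canonical data of LEMMA I**
(`twoLevel_kleitmanHall`) and LEMMA J** (`exists_face_routing`)); plan `SIGMA-ASSEMBLY-PLAN.md`.

Assembly of SCHEME Σ.  For a one-shared pair `S : OneShared ι` the unit map `φ = S.phi` (`…OneSharedPhi`)
* sends every negative unit to a positive unit at a dominating face — **`phi_adm`** (the eleven source classes of the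
  companion files `…OneSharedClassKH/Dual/Z/Displace/Row/Leaver`);
* is injective on the negative units — **`phi_injOn`**: the target signature `sig (φ u)` determines the class of `u`
  (`sig_phi_cases`, thirteen target classes, PROOF-THEOREM-I1 §3) and `φ` is injective on each class.
Hence, by the Hall form `ThreePartition.vSumT_empty_nonneg_of_unitMatchingF`, **THEOREM I₁**
(`vSumT_empty_nonneg`, and the instance-free form **`ThreePartition.vSumT_empty_nonneg_of_oneShared`**): for blocks
`I ⊔ J ⊔ {e}` of a finite type, up-sets `𝒱` depending only on the coordinates `I + e` and `𝒲` depending only on `J + e`,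
`vSumT ∅ 𝒱 𝒲 𝒳 ≥ 0` for every up-set `𝒳` of the copy order — Conjecture V (`VOrderPositivity`, file `…ThreePartitionVOrder`)
in the untwisted case for all pairs of increasing events sharing at most one coordinate.  No definitions; no `sorry`; standard axioms.
-/

namespace Summit.CriticalPhenomena.PercolationContinuityZ3.Theorems

namespace SahiFComb.Shift

open Finset FinsetFamily
open scoped Classical

variable {ι : Type*} [Fintype ι] [DecidableEq ι] [LinearOrder ι]

namespace OneShared

variable {S : OneShared ι}

/-! ### Admissibility -/

/-- **Admissibility of `φ`** (PROOF-THEOREM-I1 §2): every negative unit is sent to a positive unit at a dominating face. [this work] -/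
theorem phi_adm : ∀ u ∈ ThreePartition.negUnitSetF S.B S.C,
    S.phi u ∈ ThreePartition.posUnitSetF S.B S.C ∧ u.1.1 ⊆ (S.phi u).1.1 ∧ u.1.2 ⊆ (S.phi u).1.2 := by
  rintro ⟨⟨x, y⟩, t⟩ hu
  have hu' := hu
  rw [mem_negUnitSetF_iff] at hu'
  obtain ⟨-, h⟩ := hu'
  simp only at h
  rcases h with ⟨rfl, -, -⟩ | ⟨rfl, -, -⟩ | ⟨rfl, -, -⟩
  · by_cases hey : S.e ∈ y
    · exact phi_adm_S1 hu hey
    by_cases hex : S.e ∈ x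
    · exact phi_adm_S3 hu hex
    by_cases hA : x ∩ S.I ∈ (S.dataI y).A
    · exact phi_adm_S4b hu hex hey hA
    · exact phi_adm_S4a hu hex hey hA
  · by_cases hey : S.e ∈ y
    · exact phi_adm_S2 hu hey
    by_cases hex : S.e ∈ x
    · exact phi_adm_S5 hu hex
    by_cases hA : x ∩ S.J ∈ (S.dataJ (y ∩ S.J)).A
    · exact phi_adm_S6b hu hex hey hA
    · exact phi_adm_S6a hu hex hey hA
  · by_cases hex : S.e ∈ x
    · exact phi_adm_S7 hu hex
    by_cases hzI : (S.I \ (y ∩ S.I)) \ (x ∩ S.I) ∈ secLow (S.I \ (y ∩ S.I)) S.B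
    · exact phi_adm_S8 hu hex hzI
    by_cases hL : ((x, y), 2) ∈ S.leaverSet
    · exact phi_adm_S9b hL
    · exact phi_adm_S9a hu hex hzI hL

/-! ### The class of a negative unit is determined by the signature of its image -/

/-- **Classification** (PROOF-THEOREM-I1 §3): a negative unit `u` belongs to exactly one of the thirteen source classes,
and the class is read off from `sig (φ u)`. [this work] -/
theorem sig_phi_cases {u : (Finset ι × Finset ι) × ℕ} (hu : u ∈ ThreePartition.negUnitSetF S.B S.C) :
    (S.sig (S.phi u) = 1 ∧ (u ∈ ThreePartition.negUnitSetF S.B S.C ∧ u.2 = 0 ∧ S.e ∈ u.1.2)) ∨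
    (S.sig (S.phi u) = 2 ∧ (u ∈ ThreePartition.negUnitSetF S.B S.C ∧ u.2 = 1 ∧ S.e ∈ u.1.2)) ∨
    (S.sig (S.phi u) = 3 ∧ (u ∈ ThreePartition.negUnitSetF S.B S.C ∧ u.2 = 0 ∧ S.e ∈ u.1.1)) ∨
    (S.sig (S.phi u) = 4 ∧ (u ∈ ThreePartition.negUnitSetF S.B S.C ∧ u.2 = 0 ∧ S.e ∉ u.1.1 ∧ S.e ∉ u.1.2 ∧ u.1.1 ∩ S.I ∉ (S.dataI u.1.2).A)) ∨
    (S.sig (S.phi u) = 5 ∧ (u.2 = 0 ∧ S.e ∉ u.1.1 ∧ S.e ∉ u.1.2 ∧ ∃ hA : u.1.1 ∩ S.I ∈ (S.dataI u.1.2).A,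
      (((u.1.1 \ S.I) ∪ ((S.dataI u.1.2).GT ⟨u.1.1 ∩ S.I, hA⟩ : Finset ι) ∪ {S.e}, u.1.2), 0) ∉ S.leaverTargets)) ∨
    (S.sig (S.phi u) = 6 ∧ (u.2 = 0 ∧ S.e ∉ u.1.1 ∧ S.e ∉ u.1.2 ∧ ∃ hA : u.1.1 ∩ S.I ∈ (S.dataI u.1.2).A,
      (((u.1.1 \ S.I) ∪ ((S.dataI u.1.2).GT ⟨u.1.1 ∩ S.I, hA⟩ : Finset ι) ∪ {S.e}, u.1.2), 0) ∈ S.leaverTargets)) ∨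
    (S.sig (S.phi u) = 7 ∧ (u ∈ ThreePartition.negUnitSetF S.B S.C ∧ u.2 = 1 ∧ S.e ∈ u.1.1)) ∨
    (S.sig (S.phi u) = 8 ∧ (u ∈ ThreePartition.negUnitSetF S.B S.C ∧ u.2 = 1 ∧ S.e ∉ u.1.1 ∧ S.e ∉ u.1.2 ∧ u.1.1 ∩ S.J ∉ (S.dataJ (u.1.2 ∩ S.J)).A)) ∨
    (S.sig (S.phi u) = 9 ∧ (u.2 = 1 ∧ S.e ∉ u.1.1 ∧ S.e ∉ u.1.2 ∧ u.1.1 ∩ S.J ∈ (S.dataJ (u.1.2 ∩ S.J)).A)) ∨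
    (S.sig (S.phi u) = 10 ∧ (u ∈ ThreePartition.negUnitSetF S.B S.C ∧ u.2 = 2 ∧ S.e ∈ u.1.1)) ∨
    (S.sig (S.phi u) = 11 ∧ (u ∈ ThreePartition.negUnitSetF S.B S.C ∧ u.2 = 2 ∧ S.e ∉ u.1.1 ∧
      (S.I \ (u.1.2 ∩ S.I)) \ (u.1.1 ∩ S.I) ∈ secLow (S.I \ (u.1.2 ∩ S.I)) S.B)) ∨
    (S.sig (S.phi u) = 12 ∧ (u ∈ ThreePartition.negUnitSetF S.B S.C ∧ u.2 = 2 ∧ S.e ∉ u.1.1 ∧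
      (S.I \ (u.1.2 ∩ S.I)) \ (u.1.1 ∩ S.I) ∉ secLow (S.I \ (u.1.2 ∩ S.I)) S.B ∧ u ∉ S.leaverSet)) ∨
    (S.sig (S.phi u) = 13 ∧ (u ∈ S.leaverSet)) := by
  obtain ⟨⟨x, y⟩, t⟩ := u
  have hu' := hu
  rw [mem_negUnitSetF_iff] at hu'
  obtain ⟨-, h⟩ := hu'
  simp only at h
  simp only
  rcases h with ⟨rfl, -, -⟩ | ⟨rfl, -, -⟩ | ⟨rfl, -, -⟩
  · by_cases hey : S.e ∈ y
    · exact Or.inl ⟨sig_phi_S1 hu hey, hu, rfl, hey⟩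
    by_cases hex : S.e ∈ x
    · exact Or.inr <| Or.inr <| Or.inl ⟨sig_phi_S3 hu hex, hu, rfl, hex⟩
    by_cases hA : x ∩ S.I ∈ (S.dataI y).A
    · by_cases hLT : (((x \ S.I) ∪ ((S.dataI y).GT ⟨x ∩ S.I, hA⟩ : Finset ι) ∪ {S.e}, y), 0) ∈ S.leaverTargets
      · exact Or.inr <| Or.inr <| Or.inr <| Or.inr <| Or.inr <| Or.inl ⟨sig_phi_S4bα hu hex hey hA hLT, rfl, hex, hey, hA, hLT⟩
      · exact Or.inr <| Or.inr <| Or.inr <| Or.inr <| Or.inl ⟨sig_phi_S4bπ hex hey hA hLT, rfl, hex, hey, hA, hLT⟩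
    · exact Or.inr <| Or.inr <| Or.inr <| Or.inl ⟨sig_phi_S4a hu hex hey hA, hu, rfl, hex, hey, hA⟩
  · by_cases hey : S.e ∈ y
    · exact Or.inr <| Or.inl ⟨sig_phi_S2 hu hey, hu, rfl, hey⟩
    by_cases hex : S.e ∈ x
    · exact Or.inr <| Or.inr <| Or.inr <| Or.inr <| Or.inr <| Or.inr <| Or.inl ⟨sig_phi_S5 hu hex, hu, rfl, hex⟩
    by_cases hA : x ∩ S.J ∈ (S.dataJ (y ∩ S.J)).A
    · exact Or.inr <| Or.inr <| Or.inr <| Or.inr <| Or.inr <| Or.inr <| Or.inr <| Or.inr <| Or.inl ⟨sig_phi_S6b hu hex hey hA, rfl, hex, hey, hA⟩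
    · exact Or.inr <| Or.inr <| Or.inr <| Or.inr <| Or.inr <| Or.inr <| Or.inr <| Or.inl ⟨sig_phi_S6a hu hex hey hA, hu, rfl, hex, hey, hA⟩
  · by_cases hex : S.e ∈ x
    · exact Or.inr <| Or.inr <| Or.inr <| Or.inr <| Or.inr <| Or.inr <| Or.inr <| Or.inr <| Or.inr <| Or.inl ⟨sig_phi_S7 hu hex, hu, rfl, hex⟩
    by_cases hzI : (S.I \ (y ∩ S.I)) \ (x ∩ S.I) ∈ secLow (S.I \ (y ∩ S.I)) S.B
    · exact Or.inr <| Or.inr <| Or.inr <| Or.inr <| Or.inr <| Or.inr <| Or.inr <| Or.inr <| Or.inr <| Or.inr <| Or.inl ⟨sig_phi_S8 hu hex hzI, hu, rfl, hex, hzI⟩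
    by_cases hL : ((x, y), 2) ∈ S.leaverSet
    · exact Or.inr <| Or.inr <| Or.inr <| Or.inr <| Or.inr <| Or.inr <| Or.inr <| Or.inr <| Or.inr <| Or.inr <| Or.inr <| Or.inr <| ⟨sig_phi_S9b hL, hL⟩
    · exact Or.inr <| Or.inr <| Or.inr <| Or.inr <| Or.inr <| Or.inr <| Or.inr <| Or.inr <| Or.inr <| Or.inr <| Or.inr <| Or.inl ⟨sig_phi_S9a hu hex hzI hL, hu, rfl, hex, hzI, hL⟩

/-! ### Injectivity on each class, in terms of the class conditions of `sig_phi_cases` -/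

section InjOfClass

variable {u₁ u₂ : (Finset ι × Finset ι) × ℕ} (h : S.phi u₁ = S.phi u₂)
include h

/-- (S1) [this work] -/
theorem inj_of_S1 (c₁ : u₁ ∈ ThreePartition.negUnitSetF S.B S.C ∧ u₁.2 = 0 ∧ S.e ∈ u₁.1.2) (c₂ : u₂ ∈ ThreePartition.negUnitSetF S.B S.C ∧ u₂.2 = 0 ∧ S.e ∈ u₂.1.2) : u₁ = u₂ := by
  obtain ⟨⟨x₁, y₁⟩, t₁⟩ := u₁; obtain ⟨⟨x₂, y₂⟩, t₂⟩ := u₂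
  obtain ⟨hu₁, rfl, hey₁⟩ := c₁; obtain ⟨hu₂, rfl, hey₂⟩ := c₂
  exact inj_S1 hu₁ hey₁ hu₂ hey₂ h

/-- (S2) [this work] -/
theorem inj_of_S2 (c₁ : u₁ ∈ ThreePartition.negUnitSetF S.B S.C ∧ u₁.2 = 1 ∧ S.e ∈ u₁.1.2) (c₂ : u₂ ∈ ThreePartition.negUnitSetF S.B S.C ∧ u₂.2 = 1 ∧ S.e ∈ u₂.1.2) : u₁ = u₂ := by
  obtain ⟨⟨x₁, y₁⟩, t₁⟩ := u₁; obtain ⟨⟨x₂, y₂⟩, t₂⟩ := u₂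
  obtain ⟨hu₁, rfl, hey₁⟩ := c₁; obtain ⟨hu₂, rfl, hey₂⟩ := c₂
  exact inj_S2 hu₁ hey₁ hu₂ hey₂ h

/-- (S3) [this work] -/
theorem inj_of_S3 (c₁ : u₁ ∈ ThreePartition.negUnitSetF S.B S.C ∧ u₁.2 = 0 ∧ S.e ∈ u₁.1.1) (c₂ : u₂ ∈ ThreePartition.negUnitSetF S.B S.C ∧ u₂.2 = 0 ∧ S.e ∈ u₂.1.1) : u₁ = u₂ := by
  obtain ⟨⟨x₁, y₁⟩, t₁⟩ := u₁; obtain ⟨⟨x₂, y₂⟩, t₂⟩ := u₂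
  obtain ⟨hu₁, rfl, hex₁⟩ := c₁; obtain ⟨hu₂, rfl, hex₂⟩ := c₂
  exact inj_S3 hu₁ hex₁ hu₂ hex₂ h

/-- (S4a) [this work] -/
theorem inj_of_S4a (c₁ : u₁ ∈ ThreePartition.negUnitSetF S.B S.C ∧ u₁.2 = 0 ∧ S.e ∉ u₁.1.1 ∧ S.e ∉ u₁.1.2 ∧ u₁.1.1 ∩ S.I ∉ (S.dataI u₁.1.2).A)
    (c₂ : u₂ ∈ ThreePartition.negUnitSetF S.B S.C ∧ u₂.2 = 0 ∧ S.e ∉ u₂.1.1 ∧ S.e ∉ u₂.1.2 ∧ u₂.1.1 ∩ S.I ∉ (S.dataI u₂.1.2).A) : u₁ = u₂ := by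
  obtain ⟨⟨x₁, y₁⟩, t₁⟩ := u₁; obtain ⟨⟨x₂, y₂⟩, t₂⟩ := u₂
  obtain ⟨hu₁, rfl, hex₁, hey₁, hA₁⟩ := c₁; obtain ⟨hu₂, rfl, hex₂, hey₂, hA₂⟩ := c₂
  exact inj_S4a hu₁ hex₁ hey₁ hA₁ hu₂ hex₂ hey₂ hA₂ h

/-- (S4b, preferred) [this work] -/
theorem inj_of_S4bπ
    (c₁ : u₁.2 = 0 ∧ S.e ∉ u₁.1.1 ∧ S.e ∉ u₁.1.2 ∧ ∃ hA : u₁.1.1 ∩ S.I ∈ (S.dataI u₁.1.2).A,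
      (((u₁.1.1 \ S.I) ∪ ((S.dataI u₁.1.2).GT ⟨u₁.1.1 ∩ S.I, hA⟩ : Finset ι) ∪ {S.e}, u₁.1.2), 0) ∉ S.leaverTargets)
    (c₂ : u₂.2 = 0 ∧ S.e ∉ u₂.1.1 ∧ S.e ∉ u₂.1.2 ∧ ∃ hA : u₂.1.1 ∩ S.I ∈ (S.dataI u₂.1.2).A,
      (((u₂.1.1 \ S.I) ∪ ((S.dataI u₂.1.2).GT ⟨u₂.1.1 ∩ S.I, hA⟩ : Finset ι) ∪ {S.e}, u₂.1.2), 0) ∉ S.leaverTargets) :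
    u₁ = u₂ := by
  obtain ⟨⟨x₁, y₁⟩, t₁⟩ := u₁; obtain ⟨⟨x₂, y₂⟩, t₂⟩ := u₂
  obtain ⟨rfl, hex₁, hey₁, hA₁, hLT₁⟩ := c₁; obtain ⟨rfl, hex₂, hey₂, hA₂, hLT₂⟩ := c₂
  exact inj_S4bπ hex₁ hey₁ hA₁ hLT₁ hex₂ hey₂ hA₂ hLT₂ h

/-- (S4b, displaced) [this work] -/
theorem inj_of_S4bα
    (c₁ : u₁.2 = 0 ∧ S.e ∉ u₁.1.1 ∧ S.e ∉ u₁.1.2 ∧ ∃ hA : u₁.1.1 ∩ S.I ∈ (S.dataI u₁.1.2).A,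
      (((u₁.1.1 \ S.I) ∪ ((S.dataI u₁.1.2).GT ⟨u₁.1.1 ∩ S.I, hA⟩ : Finset ι) ∪ {S.e}, u₁.1.2), 0) ∈ S.leaverTargets)
    (c₂ : u₂.2 = 0 ∧ S.e ∉ u₂.1.1 ∧ S.e ∉ u₂.1.2 ∧ ∃ hA : u₂.1.1 ∩ S.I ∈ (S.dataI u₂.1.2).A,
      (((u₂.1.1 \ S.I) ∪ ((S.dataI u₂.1.2).GT ⟨u₂.1.1 ∩ S.I, hA⟩ : Finset ι) ∪ {S.e}, u₂.1.2), 0) ∈ S.leaverTargets) :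
    u₁ = u₂ := by
  obtain ⟨⟨x₁, y₁⟩, t₁⟩ := u₁; obtain ⟨⟨x₂, y₂⟩, t₂⟩ := u₂
  obtain ⟨rfl, hex₁, hey₁, hA₁, hLT₁⟩ := c₁; obtain ⟨rfl, hex₂, hey₂, hA₂, hLT₂⟩ := c₂
  exact inj_S4bα hex₁ hey₁ hA₁ hLT₁ hex₂ hey₂ hA₂ hLT₂ h

/-- (S5) [this work] -/
theorem inj_of_S5 (c₁ : u₁ ∈ ThreePartition.negUnitSetF S.B S.C ∧ u₁.2 = 1 ∧ S.e ∈ u₁.1.1) (c₂ : u₂ ∈ ThreePartition.negUnitSetF S.B S.C ∧ u₂.2 = 1 ∧ S.e ∈ u₂.1.1) : u₁ = u₂ := by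
  obtain ⟨⟨x₁, y₁⟩, t₁⟩ := u₁; obtain ⟨⟨x₂, y₂⟩, t₂⟩ := u₂
  obtain ⟨hu₁, rfl, hex₁⟩ := c₁; obtain ⟨hu₂, rfl, hex₂⟩ := c₂
  exact inj_S5 hu₁ hex₁ hu₂ hex₂ h

/-- (S6a) [this work] -/
theorem inj_of_S6a (c₁ : u₁ ∈ ThreePartition.negUnitSetF S.B S.C ∧ u₁.2 = 1 ∧ S.e ∉ u₁.1.1 ∧ S.e ∉ u₁.1.2 ∧ u₁.1.1 ∩ S.J ∉ (S.dataJ (u₁.1.2 ∩ S.J)).A)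
    (c₂ : u₂ ∈ ThreePartition.negUnitSetF S.B S.C ∧ u₂.2 = 1 ∧ S.e ∉ u₂.1.1 ∧ S.e ∉ u₂.1.2 ∧ u₂.1.1 ∩ S.J ∉ (S.dataJ (u₂.1.2 ∩ S.J)).A) :
    u₁ = u₂ := by
  obtain ⟨⟨x₁, y₁⟩, t₁⟩ := u₁; obtain ⟨⟨x₂, y₂⟩, t₂⟩ := u₂
  obtain ⟨hu₁, rfl, hex₁, hey₁, hA₁⟩ := c₁; obtain ⟨hu₂, rfl, hex₂, hey₂, hA₂⟩ := c₂
  exact inj_S6a hu₁ hex₁ hey₁ hA₁ hu₂ hex₂ hey₂ hA₂ h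

/-- (S6b) [this work] -/
theorem inj_of_S6b (c₁ : u₁.2 = 1 ∧ S.e ∉ u₁.1.1 ∧ S.e ∉ u₁.1.2 ∧ u₁.1.1 ∩ S.J ∈ (S.dataJ (u₁.1.2 ∩ S.J)).A)
    (c₂ : u₂.2 = 1 ∧ S.e ∉ u₂.1.1 ∧ S.e ∉ u₂.1.2 ∧ u₂.1.1 ∩ S.J ∈ (S.dataJ (u₂.1.2 ∩ S.J)).A) : u₁ = u₂ := by
  obtain ⟨⟨x₁, y₁⟩, t₁⟩ := u₁; obtain ⟨⟨x₂, y₂⟩, t₂⟩ := u₂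
  obtain ⟨rfl, hex₁, hey₁, hA₁⟩ := c₁; obtain ⟨rfl, hex₂, hey₂, hA₂⟩ := c₂
  exact inj_S6b hex₁ hey₁ hA₁ hex₂ hey₂ hA₂ h

/-- (S7) [this work] -/
theorem inj_of_S7 (c₁ : u₁ ∈ ThreePartition.negUnitSetF S.B S.C ∧ u₁.2 = 2 ∧ S.e ∈ u₁.1.1) (c₂ : u₂ ∈ ThreePartition.negUnitSetF S.B S.C ∧ u₂.2 = 2 ∧ S.e ∈ u₂.1.1) : u₁ = u₂ := by
  obtain ⟨⟨x₁, y₁⟩, t₁⟩ := u₁; obtain ⟨⟨x₂, y₂⟩, t₂⟩ := u₂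
  obtain ⟨hu₁, rfl, hex₁⟩ := c₁; obtain ⟨hu₂, rfl, hex₂⟩ := c₂
  exact inj_S7 hu₁ hex₁ hu₂ hex₂ h

/-- (S8) [this work] -/
theorem inj_of_S8
    (c₁ : u₁ ∈ ThreePartition.negUnitSetF S.B S.C ∧ u₁.2 = 2 ∧ S.e ∉ u₁.1.1 ∧
      (S.I \ (u₁.1.2 ∩ S.I)) \ (u₁.1.1 ∩ S.I) ∈ secLow (S.I \ (u₁.1.2 ∩ S.I)) S.B)
    (c₂ : u₂ ∈ ThreePartition.negUnitSetF S.B S.C ∧ u₂.2 = 2 ∧ S.e ∉ u₂.1.1 ∧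
      (S.I \ (u₂.1.2 ∩ S.I)) \ (u₂.1.1 ∩ S.I) ∈ secLow (S.I \ (u₂.1.2 ∩ S.I)) S.B) : u₁ = u₂ := by
  obtain ⟨⟨x₁, y₁⟩, t₁⟩ := u₁; obtain ⟨⟨x₂, y₂⟩, t₂⟩ := u₂
  obtain ⟨hu₁, rfl, hex₁, hzI₁⟩ := c₁; obtain ⟨hu₂, rfl, hex₂, hzI₂⟩ := c₂
  exact inj_S8 hu₁ hex₁ hzI₁ hu₂ hex₂ hzI₂ h

/-- (S9a) [this work] -/
theorem inj_of_S9a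
    (c₁ : u₁ ∈ ThreePartition.negUnitSetF S.B S.C ∧ u₁.2 = 2 ∧ S.e ∉ u₁.1.1 ∧
      (S.I \ (u₁.1.2 ∩ S.I)) \ (u₁.1.1 ∩ S.I) ∉ secLow (S.I \ (u₁.1.2 ∩ S.I)) S.B ∧ u₁ ∉ S.leaverSet)
    (c₂ : u₂ ∈ ThreePartition.negUnitSetF S.B S.C ∧ u₂.2 = 2 ∧ S.e ∉ u₂.1.1 ∧
      (S.I \ (u₂.1.2 ∩ S.I)) \ (u₂.1.1 ∩ S.I) ∉ secLow (S.I \ (u₂.1.2 ∩ S.I)) S.B ∧ u₂ ∉ S.leaverSet) : u₁ = u₂ := by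
  obtain ⟨⟨x₁, y₁⟩, t₁⟩ := u₁; obtain ⟨⟨x₂, y₂⟩, t₂⟩ := u₂
  obtain ⟨hu₁, rfl, hex₁, hzI₁, hL₁⟩ := c₁; obtain ⟨hu₂, rfl, hex₂, hzI₂, hL₂⟩ := c₂
  exact inj_S9a hu₁ hex₁ hzI₁ hL₁ hu₂ hex₂ hzI₂ hL₂ h

/-- (S9b) [this work] -/
theorem inj_of_S9b (c₁ : u₁ ∈ S.leaverSet) (c₂ : u₂ ∈ S.leaverSet) : u₁ = u₂ := by
  obtain ⟨⟨x₁, y₁⟩, t₁⟩ := u₁; obtain ⟨⟨x₂, y₂⟩, t₂⟩ := u₂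
  obtain ⟨-, ht₁, -⟩ := (S.mem_leaverSet _).1 c₁; obtain ⟨-, ht₂, -⟩ := (S.mem_leaverSet _).1 c₂
  simp only at ht₁ ht₂
  subst ht₁; subst ht₂
  exact inj_S9b c₁ c₂ h

end InjOfClass

/-! ### Injectivity -/

/-- **Injectivity of `φ`** on the negative units (PROOF-THEOREM-I1 §3). [this work] -/
theorem phi_injOn : Set.InjOn S.phi (ThreePartition.negUnitSetF S.B S.C) := by
  intro u₁ hu₁ u₂ hu₂ h
  have hs : S.sig (S.phi u₁) = S.sig (S.phi u₂) := by rw [h]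
  rcases sig_phi_cases hu₁ with ⟨h₁, c₁⟩ | ⟨h₁, c₁⟩ | ⟨h₁, c₁⟩ | ⟨h₁, c₁⟩ | ⟨h₁, c₁⟩ | ⟨h₁, c₁⟩ | ⟨h₁, c₁⟩ |
    ⟨h₁, c₁⟩ | ⟨h₁, c₁⟩ | ⟨h₁, c₁⟩ | ⟨h₁, c₁⟩ | ⟨h₁, c₁⟩ | ⟨h₁, c₁⟩
  all_goals
    rcases sig_phi_cases hu₂ with ⟨h₂, c₂⟩ | ⟨h₂, c₂⟩ | ⟨h₂, c₂⟩ | ⟨h₂, c₂⟩ | ⟨h₂, c₂⟩ | ⟨h₂, c₂⟩ | ⟨h₂, c₂⟩ |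
      ⟨h₂, c₂⟩ | ⟨h₂, c₂⟩ | ⟨h₂, c₂⟩ | ⟨h₂, c₂⟩ | ⟨h₂, c₂⟩ | ⟨h₂, c₂⟩
    all_goals rw [h₁, h₂] at hs
    all_goals first
      | exact absurd hs (by decide)
      | exact inj_of_S1 h c₁ c₂
      | exact inj_of_S2 h c₁ c₂
      | exact inj_of_S3 h c₁ c₂
      | exact inj_of_S4a h c₁ c₂
      | exact inj_of_S4bπ h c₁ c₂
      | exact inj_of_S4bα h c₁ c₂
      | exact inj_of_S5 h c₁ c₂
      | exact inj_of_S6a h c₁ c₂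
      | exact inj_of_S6b h c₁ c₂
      | exact inj_of_S7 h c₁ c₂
      | exact inj_of_S8 h c₁ c₂
      | exact inj_of_S9a h c₁ c₂
      | exact inj_of_S9b h c₁ c₂

/-! ### THEOREM I₁ -/

/-- **THEOREM I₁** (structure form): for a one-shared-coordinate pair `S` whose families represent the set families `𝒱`, `𝒲`,
`vSumT ∅ 𝒱 𝒲 𝒳 ≥ 0` for every up-set `𝒳` of the copy order. [this work] -/
theorem vSumT_empty_nonneg (S : OneShared ι) (𝒱 𝒲 : Set (Set ι)) (hB : ∀ s : Finset ι, s ∈ S.B ↔ (s : Set ι) ∈ 𝒱)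
    (hC : ∀ s : Finset ι, s ∈ S.C ↔ (s : Set ι) ∈ 𝒲) (𝒳 : Set (Set ι × Set ι)) (h𝒳 : IsUpperSet 𝒳) :
    0 ≤ ThreePartition.vSumT ∅ 𝒱 𝒲 𝒳 :=
  ThreePartition.vSumT_empty_nonneg_of_unitMatchingF 𝒱 𝒲 S.B S.C hB hC S.phi phi_adm phi_injOn 𝒳 h𝒳

end OneShared

end SahiFComb.Shift

/-- **THEOREM I₁: Conjecture V (untwisted) for one-shared-coordinate pairs.**  Let `ι = I ⊔ J ⊔ {e}` be a finite type,
`𝒱` an up-set of `Set ι` depending only on the coordinates `I + e` and `𝒲` an up-set depending only on `J + e`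
(two increasing events sharing at most the coordinate `e`).  Then `vSumT ∅ 𝒱 𝒲 𝒳 ≥ 0` for every up-set `𝒳` of the copy
order — the inequality of `VOrderPositivity` (file `…ThreePartitionVOrder`) with twist `τ = ∅` for this class of pairs.
Proof: SCHEME Σ (`SahiFComb.Shift.OneShared.phi`, admissible and injective) and the Hall form
`vSumT_empty_nonneg_of_unitMatchingF`. [this work] -/
theorem ThreePartition.vSumT_empty_nonneg_of_oneShared {ι : Type*} [Fintype ι] (I J : Finset ι) (e : ι)
    (hIJ : Disjoint I J) (heI : e ∉ I) (heJ : e ∉ J) (hcov : ∀ i, i = e ∨ i ∈ I ∨ i ∈ J)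
    (𝒱 𝒲 : Set (Set ι)) (h𝒱 : IsUpperSet 𝒱) (h𝒲 : IsUpperSet 𝒲)
    (hdep𝒱 : ∀ s : Set ι, s ∈ 𝒱 ↔ s ∩ insert e ↑I ∈ 𝒱) (hdep𝒲 : ∀ s : Set ι, s ∈ 𝒲 ↔ s ∩ insert e ↑J ∈ 𝒲)
    (𝒳 : Set (Set ι × Set ι)) (h𝒳 : IsUpperSet 𝒳) : 0 ≤ ThreePartition.vSumT ∅ 𝒱 𝒲 𝒳 := by
  classical
  letI : LinearOrder ι := LinearOrder.lift' (Fintype.equivFin ι) (Fintype.equivFin ι).injective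
  have hup : ∀ (𝒰 : Set (Set ι)), IsUpperSet 𝒰 → ∀ s ∈ (Finset.univ.filter fun s : Finset ι => (s : Set ι) ∈ 𝒰),
      ∀ s', s ⊆ s' → s' ⊆ (Finset.univ : Finset ι) → s' ∈ (Finset.univ.filter fun s : Finset ι => (s : Set ι) ∈ 𝒰) := by
    intro 𝒰 h𝒰 s hs s' hss' _
    rw [Finset.mem_filter] at hs ⊢
    exact ⟨Finset.mem_univ _, h𝒰 (Finset.coe_subset.2 hss') hs.2⟩
  have hdep : ∀ (𝒰 : Set (Set ι)) (K : Finset ι), (∀ s : Set ι, s ∈ 𝒰 ↔ s ∩ insert e ↑K ∈ 𝒰) →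
      ∀ s : Finset ι, s ∈ (Finset.univ.filter fun s : Finset ι => (s : Set ι) ∈ 𝒰) ↔
        s ∩ insert e K ∈ (Finset.univ.filter fun s : Finset ι => (s : Set ι) ∈ 𝒰) := by
    intro 𝒰 K h s
    simp only [Finset.mem_filter, Finset.mem_univ, true_and, Finset.coe_inter, Finset.coe_insert]
    exact h s
  let S : SahiFComb.Shift.OneShared ι :=
    { I := I, J := J, e := e,
      B := Finset.univ.filter fun s : Finset ι => (s : Set ι) ∈ 𝒱,
      C := Finset.univ.filter fun s : Finset ι => (s : Set ι) ∈ 𝒲,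
      hBup := hup 𝒱 h𝒱, hCup := hup 𝒲 h𝒲, hIJ := hIJ, heI := heI, heJ := heJ, hcov := hcov,
      hdepB := hdep 𝒱 I hdep𝒱, hdepC := hdep 𝒲 J hdep𝒲 }
  refine S.vSumT_empty_nonneg 𝒱 𝒲 (fun s => ?_) (fun s => ?_) 𝒳 h𝒳
  · show s ∈ (Finset.univ.filter fun s : Finset ι => (s : Set ι) ∈ 𝒱) ↔ _
    rw [Finset.mem_filter]; exact ⟨fun h => h.2, fun h => ⟨Finset.mem_univ _, h⟩⟩
  · show s ∈ (Finset.univ.filter fun s : Finset ι => (s : Set ι) ∈ 𝒲) ↔ _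
    rw [Finset.mem_filter]; exact ⟨fun h => h.2, fun h => ⟨Finset.mem_univ _, h⟩⟩

end Summit.CriticalPhenomena.PercolationContinuityZ3.Theorems
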